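import Summits.AnomalousDissipation.AnomalousDissipation.Theorems.SolenoidalFractalHomogenisationLagrangianCarrierConstructionTowerData
import Summits.AnomalousDissipation.AnomalousDissipation.Theorems.SolenoidalFractalHomogenisationLagrangianCarrierConstructionTowerLevelContinuity
import Summits.AnomalousDissipation.AnomalousDissipation.Theorems.SolenoidalFractalHomogenisationLagrangianCarrierConstructionTowerDivFree
import Literature.Analysis.FluidPDE.AdditiveNoiseMeasurePreserving
import HarnessLib

/-!
# K3L `LagrangianCarrierConstruction` (stmt-AnomalousDissipation-24913), line `birth`: the Lagrangian insertion with every clause of `LevelRegular`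
# except (R0) (refuted at this generality) and the uniform derivative bounds (L3b), (F1c) (helper; `--supports stmt-AnomalousDissipation-24913`)

Summits-side helper file (everything proved; no definitions, no named facts). `exists_isLagrangian_divFree`: over every Lagrangian
lattice carrier datum with commensurable refresh windows — (W1) every window of level `m+1` is a whole number of physical periods of
level `m+1`, (W2) the windows are nested — there are level fields / displacements with the same bookkeeping such that
`IsLagrangian` holds together with the following clauses of `LevelRegular`: (L1) every level field `b (m+1)` is JOINTLY continuous in
`(t, x)` — across the window resets too, because by (W1) the Eulerian level vanishes at every window boundary (its slot envelopes
vanish at whole periods), so the inserted level is, on every CLOSED window, the window's fixed-frame formula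
(`…TowerLevelContinuity.continuous_inserted_level`); (L2) WEAKLY DIVERGENCE FREE at every time — the pushforward of the weakly
divergence-free Eulerian level by the volume-preserving coarse flow, by change of variables (`…TowerDivFree.isWeaklyDivFree_pushforward`);
(L3a) smooth in space; (L4) time periodic (period `refresh 1`); (F1a) every
displacement `disp m · s ·` is jointly continuous (`…TowerLevelContinuity.continuous_disp_of_slabs`); (F1b) smooth in space; (F2) `X m s s = id`,
group law, volume preservation. The tower itself is `…TowerData.exists_tower`. What is NOT here: (R0) (false at this generality,
`…Negative.StubFlowsLFalse.stub_flowsL_false`) and (L3b)/(F1c), the `x`-derivative bounds uniform in time. Infrastructure for route-1's rung leaf F-D1.A0 (a frontier FORMAL rung); NOT a proof of anomalous dissipation.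
-/

set_option linter.dupNamespace false

noncomputable section

namespace Summit.AnomalousDissipation.AnomalousDissipation.Theorems.SolenoidalFractalHomogenisation.LagrangianCarrierConstruction

open Set Function Filter Topology Metric MeasureTheory
open scoped NNReal ContDiff
open Literature.Analysis Literature.Analysis.ODE Literature.Analysis.FunctionSpaces Literature.Analysis.FunctionSpaces.Torus
open Literature.Analysis.FluidPDE Literature.Analysis.FluidPDE.LatticeShear
open Summit.AnomalousDissipation.AnomalousDissipation.Theorems.SolenoidalFractalHomogenisation.PermissibleCarrier
  (isSmooth_level isWeaklyDivFree_level trapezoid_start_zero period_pos)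

/-- **The Lagrangian insertion with continuous, weakly divergence-free, smooth, periodic levels and volume-preserving flows** (clauses
`IsLagrangian`, (L1), (L2), (L3a), (L4), (F1a), (F1b), (F2a–c) of `LevelRegular`) under (W1), (W2). [cite: ArmstrongVicol2025, §2.2 (PDF pp. 12, 18: b_m = b_{m−1} + Σ_l 𝟙 v_m(t, X_{m−1}^{-1}(t,x,lτ″_m)); the flows X_m)] -/
theorem exists_isLagrangian_divFree : ∀ k (E : Literature.Analysis.FluidPDE.LatticeShear.LagrangianLatticeCarrier k), (∀ m, ∃ r : ℕ, 0 < r ∧ E.refresh (m + 1) = (r : ℝ) * E.toFractalCarrierData.physPeriod (m + 1)) → (∀ m, ∃ q : ℕ, 0 < q ∧ E.refresh m = (q : ℝ) * E.refresh (m + 1)) → ∃ E' : Literature.Analysis.FluidPDE.LatticeShear.LagrangianLatticeCarrier k, E'.toFractalCarrierData = E.toFractalCarrierData ∧ E'.refresh = E.refresh ∧ E'.θ = E.θ ∧ E'.IsLagrangian ∧ (∀ m, Continuous (Function.uncurry (E'.b (m + 1)))) ∧ (∀ m t, Torus.IsWeaklyDivFree (E'.b (m + 1) t)) ∧ (∀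 m t, Torus.IsSmooth (E'.b (m + 1) t)) ∧ (∀ m, ∃ τ : ℝ, 0 < τ ∧ Function.Periodic (E'.b (m + 1)) τ) ∧ (∀ m s, Continuous fun p : ℝ × UnitAddTorus (Fin 3) => E'.disp m p.1 s p.2) ∧ (∀ m t s, Torus.IsSmooth (E'.disp m t s)) ∧ (∀ m s, E'.X m s s = id) ∧ (∀ m t s r, E'.X m t s ∘ E'.X m s r = E'.X m t r) ∧ (∀ m t s, MeasureTheory.MeasurePreserving (E'.X m t s) volume volume) := by
  intro k E hW1 hW2
  -- the lifted Eulerian level fields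
  obtain ⟨v, hv⟩ : ∃ v : ℕ → ℝ → EuclideanSpace ℝ (Fin 3) → EuclideanSpace ℝ (Fin 3),
      ∀ m t z, v m t z = E.toFractalCarrierData.level m t (proj z) := ⟨_, fun _ _ _ => rfl⟩
  have hvE : ∀ m, v m = fun t z => E.toFractalCarrierData.level m t (proj z) := fun m => funext fun t => funext fun z => hv m t z
  have hvper : ∀ m t z (n : Fin 3 → ℤ), v m t (z + latticeVec n) = v m t z := fun m t z n => by
    rw [hv, hv, level_proj_add_latticeVec]
  have hvc : ∀ m, Continuous (uncurry (v m)) := fun m => by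
    have h := (isUniformlyLipschitzOn_level_proj E.toFractalCarrierData m).continuousOn_uncurry convex_univ
    rw [univ_prod_univ, continuousOn_univ] at h
    rw [hvE]; exact h
  -- (W1): the Eulerian level `m+1` vanishes at every window boundary of level `m+1`
  have hvan : ∀ m (j : ℤ) z, v (m + 1) ((j : ℝ) * E.refresh (m + 1)) z = 0 := by
    intro m j z
    obtain ⟨r, -, hr⟩ := hW1 m
    rw [hv, level_proj_eq_sum]
    have ha : E.toFractalCarrierData.a (m + 1) ≠ 0 := (E.toFractalCarrierData.a_pos _).ne'
    have hP : (E.toFractalCarrierData.word (m + 1)).period ≠ 0 := (period_pos _).ne'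
    have hq : E.toFractalCarrierData.a (m + 1) * ((j : ℝ) * E.refresh (m + 1)) / (E.toFractalCarrierData.word (m + 1)).period =
        ((j * r : ℤ) : ℝ) := by
      rw [hr]
      unfold FractalCarrierData.physPeriod
      push_cast
      field_simp
    rw [hq, Int.fract_intCast, zero_mul]
    simp only [trapezoid_start_zero, zero_smul, Finset.sum_const_zero, smul_zero]
  -- the tower
  obtain ⟨A, Bs, Ds, hB0, hBsucc, hINV, hDET, hPER, hINSper⟩ := exists_tower E hW1 hW2
  -- the inserted velocities
  obtain ⟨INS, hINS⟩ : ∃ INS : ℕ → ℝ → EuclideanSpace ℝ (Fin 3) → EuclideanSpace ℝ (Fin 3), ∀ m t z, INS m t z =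
      fderiv ℝ (fun y => A m t ((A m ((⌊t / E.refresh (m + 1)⌋ : ℝ) * E.refresh (m + 1))).symm y))
        (A m ((⌊t / E.refresh (m + 1)⌋ : ℝ) * E.refresh (m + 1)) ((A m t).symm z))
        (v (m + 1) t (A m ((⌊t / E.refresh (m + 1)⌋ : ℝ) * E.refresh (m + 1)) ((A m t).symm z))) := ⟨_, fun _ _ _ => rfl⟩
  have hBsucc' : ∀ m, Bs (m + 1) = fun t z => Bs m t z + INS m t z := fun m => by
    rw [hBsucc m]; funext t z; rw [hINS, hv]
  have hINSper' : ∀ m t z, INS m (t + E.refresh 1) z = INS m t z := fun m t z => by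
    rw [hINS, hINS, hv, hv]; exact hINSper m t z
  -- the level fields and displacements on the torus
  obtain ⟨bf, hb0, hbS⟩ : ∃ bf : ℕ → ℝ → UnitAddTorus (Fin 3) → EuclideanSpace ℝ (Fin 3),
      (∀ t x, bf 0 t x = 0) ∧ ∀ m t x, bf (m + 1) t x = INS m t (repr x) :=
    ⟨fun m t x => match m with | 0 => 0 | m + 1 => INS m t (repr x), fun _ _ => rfl, fun _ _ _ => rfl⟩
  obtain ⟨dsp, hdsp⟩ : ∃ dsp : ℕ → ℝ → ℝ → UnitAddTorus (Fin 3) → EuclideanSpace ℝ (Fin 3),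
      ∀ m t s x, dsp m t s x = A m t ((A m s).symm (repr x)) - repr x := ⟨_, fun _ _ _ _ => rfl⟩
  -- the partial sums of the level fields are the tower velocities
  have hsum : ∀ m t z, ∑ i ∈ Finset.range m, bf (i + 1) t (proj z) = Bs m t z := by
    intro m
    induction m with
    | zero => intro t z; simp [hB0]
    | succ n ih =>
      intro t z
      rw [Finset.sum_range_succ, ih, hBsucc', hbS]
      -- periodicity of the inserted velocity through `repr ∘ proj`
      have hper : ∀ y (k' : Fin 3 → ℤ), INS n t (y + latticeVec k') = INS n t y := fun y k' =>
        by rw [hINS, hINS]; exact inserted_add_latticeVec (A n) (v (n + 1)) t _ (hINV n).1 (hvper _) y k'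
      simp only []
      rw [periodic_repr_proj hper]
  -- smoothness of the tower at all orders
  have hAinf : ∀ m t, ContDiff ℝ ∞ (A m t) ∧ ContDiff ℝ ∞ (A m t).symm := fun m t => by
    obtain ⟨-, i3, i3', -, -, -, -, -, -, -, -, -⟩ := hINV m
    constructor
    · refine contDiff_infty.2 fun n => ?_
      obtain ⟨ε, hε, hR1, -⟩ := i3 (max n 1) (le_max_right _ _) t
      have h := hR1.comp_contDiff (contDiff_const.prodMk contDiff_id) fun _ => ⟨⟨le_rfl, by linarith⟩, mem_univ _⟩
      exact h.of_le (by exact_mod_cast le_max_left n 1)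
    · refine contDiff_infty.2 fun n => ?_
      obtain ⟨ε, hε, hR1, -⟩ := i3' (max n 1) (le_max_right _ _) t
      have h := hR1.comp_contDiff (contDiff_const.prodMk contDiff_id) fun _ => ⟨⟨le_rfl, by linarith⟩, mem_univ _⟩
      exact h.of_le (by exact_mod_cast le_max_left n 1)
  have hXeqm : ∀ m t s z (k' : Fin 3 → ℤ), A m t ((A m s).symm (z + latticeVec k')) = A m t ((A m s).symm z) + latticeVec k' :=
    fun m t s z k' => by rw [equivariant_symm ((hINV m).1 s), (hINV m).1]
  -- (F2c) as a lemma: every flow map preserves the volume of the torus (Liouville)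
  have hMPall : ∀ m t s, MeasurePreserving (fun x : UnitAddTorus (Fin 3) => x + proj (dsp m t s x)) volume volume := by
    intro m t s
    have hAc : ContDiff ℝ 1 (A m t) ∧ ContDiff ℝ 1 (A m s).symm :=
      ⟨(hAinf m t).1.of_le (by exact_mod_cast le_top), (hAinf m s).2.of_le (by exact_mod_cast le_top)⟩
    have hX1 : ContDiff ℝ 1 fun z => A m t ((A m s).symm z) := hAc.1.comp hAc.2
    refine Literature.Analysis.FluidPDE.Torus.measurePreserving_of_equivariant_det_one
      (X := fun z => A m t ((A m s).symm z)) (X' := fun y => fderiv ℝ (fun z => A m t ((A m s).symm z)) y)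
      (fun y => ((hX1.differentiable (by simp)) y).hasFDerivAt) (fun y => ?_) ((A m s).symm.trans (A m t)).bijective
      (hXeqm m t s) ?_ (fun y => ?_)
    · rw [det_fderiv_comp hAc.1 hAc.2, (hDET m t).1, (hDET m s).2, mul_one]
    · -- measurability: the torus map is continuous
      have hl : Torus.lift (dsp m t s) = fun z => A m t ((A m s).symm z) - z := by
        funext z
        have e : dsp m t s = fun x => (fun y' => A m t ((A m s).symm y')) (repr x) - repr x := funext fun x => hdsp m t s x
        rw [e]
        exact lift_disp_eq (F := fun y' => A m t ((A m s).symm y')) (hXeqm m t s) z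
      have hc : Continuous (dsp m t s) := by
        rw [← Torus.continuous_lift_iff, hl]
        exact hX1.continuous.sub continuous_id
      have hX : Continuous fun x : UnitAddTorus (Fin 3) => x + proj (dsp m t s x) :=
        continuous_id.add (Torus.continuous_proj.comp hc)
      exact hX.measurable
    · show proj y + proj (dsp m t s (proj y)) = proj (A m t ((A m s).symm y))
      rw [hdsp, add_proj_disp_eq (fun y' => A m t ((A m s).symm y')) (proj y)]
      obtain ⟨k', hk'⟩ := exists_repr_proj_eq_add_latticeVec_holds y
      rw [hk', hXeqm m t s, Torus.proj_add_latticeVec]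
  refine ⟨⟨E.toFractalCarrierData, E.refresh, E.θ, bf, dsp, E.refresh_pos, E.θ_pos⟩, rfl, rfl, rfl, fun m => ⟨?_, ?_⟩,
    fun m => ?_, fun m t => ?_, fun m t => ?_, fun m => ⟨E.refresh 1, E.refresh_pos 1, fun t => ?_⟩, fun m s => ?_, fun m t s => ?_, fun m s => ?_,
    fun m t s r => ?_, fun m t s => ?_⟩
  · -- `IsFlow m`: the integral form of the flow equation of `A m`
    intro t s x
    obtain ⟨i1, i3, -, i4, -, -, i5, i7a, i7b, i7c, -, -⟩ := hINV m
    have i3₁ := i3 1 le_rfl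
    set z₀ : EuclideanSpace ℝ (Fin 3) := (A m s).symm (repr x) with hz₀
    show dsp m t s x = ∫ r in s..t, ∑ i ∈ Finset.range m, bf (i + 1) r (x + proj (dsp m r s x))
    have hX : ∀ r, x + proj (dsp m r s x) = proj (A m r z₀) := fun r => by
      rw [hdsp]; exact add_proj_disp_eq (fun y => A m r ((A m s).symm y)) x
    simp only [hX, hsum]
    have hcontA : Continuous fun r => A m r z₀ := continuous_apply_of_slabs (A m) i3₁ z₀
    have hcont : Continuous fun r => A m r z₀ - repr x := hcontA.sub continuous_const
    have hderiv : ∀ r ∉ Ds m, HasDerivAt (fun r => A m r z₀ - repr x) (Bs m r (A m r z₀)) r :=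
      fun r hr => (i5 r hr z₀).sub_const _
    have hint : ∀ a b : ℝ, IntervalIntegrable (fun r => Bs m r (A m r z₀)) volume a b := by
      refine intervalIntegrable_of_bounded_of_continuousAt_off_countable i4 (fun r hr => ?_) (fun a b => ?_)
      · exact ContinuousAt.comp_of_eq (i7c r hr (A m r z₀)) (continuous_id.prodMk hcontA).continuousAt rfl
      · obtain ⟨C, hC⟩ := i7b a b
        exact ⟨C, fun r hr => hC r hr _⟩
    rw [integral_eq_sub_of_hasDerivAt_off_countable i4 hcont hderiv hint s t, hdsp]
    have hFs : A m s z₀ = repr x := by rw [hz₀]; exact Equiv.apply_symm_apply _ _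
    rw [hFs, sub_self, sub_zero]
  · -- `IsInserted m`: the level `m+1` field is the pushed-forward Eulerian level, window by window
    intro j t ht y
    obtain ⟨i1, -, -, -, -, -, -, -, -, -, -, -⟩ := hINV m
    have hAc : ∀ τ, ContDiff ℝ 1 (A m τ) ∧ ContDiff ℝ 1 (A m τ).symm := fun τ =>
      ⟨(hAinf m τ).1.of_le (by exact_mod_cast le_top), (hAinf m τ).2.of_le (by exact_mod_cast le_top)⟩
    set s : ℝ := (j : ℝ) * E.refresh (m + 1) with hs
    -- the frame: equivariance and smoothness of `X(t, s) = A t ∘ (A s)⁻¹`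
    have hXeq : ∀ z (k' : Fin 3 → ℤ), A m t ((A m s).symm (z + latticeVec k')) = A m t ((A m s).symm z) + latticeVec k' :=
      fun z k' => by rw [equivariant_symm (i1 s), i1]
    have hXd : Differentiable ℝ fun z => A m t ((A m s).symm z) :=
      ((hAc t).1.comp (hAc s).2).differentiable (by simp)
    show bf (m + 1) t (y + proj (dsp m t s y)) =
      (ContinuousLinearMap.id ℝ (EuclideanSpace ℝ (Fin 3)) + fderiv ℝ (Torus.lift (dsp m t s)) (repr y))
        (E.toFractalCarrierData.level (m + 1) t y)
    -- left-hand side: the inserted velocity at the pushed point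
    have hX : y + proj (dsp m t s y) = proj (A m t ((A m s).symm (repr y))) := by
      rw [hdsp]; exact add_proj_disp_eq (fun y' => A m t ((A m s).symm y')) y
    have hper : ∀ z (k' : Fin 3 → ℤ), INS m t (z + latticeVec k') = INS m t z := fun z k' => by
      rw [hINS, hINS]; exact inserted_add_latticeVec (A m) (v (m + 1)) t _ i1 (hvper _) z k'
    have hfl : ⌊t / E.refresh (m + 1)⌋ = j := floor_eq_of_mem_Ico (E.refresh_pos _) ht
    rw [hX, hbS, periodic_repr_proj hper]
    simp only [hINS, hfl, ← hs, Equiv.symm_apply_apply, Equiv.apply_symm_apply, hv, proj_repr]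
    -- right-hand side: the derivative of the lifted displacement
    have hl : Torus.lift (dsp m t s) = fun z => A m t ((A m s).symm z) - z := by
      funext z
      have e : dsp m t s = fun x => (fun y' => A m t ((A m s).symm y')) (repr x) - repr x := funext fun x => hdsp m t s x
      rw [e]
      exact lift_disp_eq (F := fun y' => A m t ((A m s).symm y')) hXeq z
    have hF : HasFDerivAt (fun z => A m t ((A m s).symm z) - z)
        (fderiv ℝ (fun y' => A m t ((A m s).symm y')) (repr y) - ContinuousLinearMap.id ℝ (EuclideanSpace ℝ (Fin 3)))
        (repr y) := ((hXd _).hasFDerivAt).sub (hasFDerivAt_id _)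
    rw [hl, hF.fderiv]
    simp

  · -- (L1) every level field is jointly continuous in `(t, x)` (the Eulerian level vanishes at the window boundaries)
    obtain ⟨i1, i3, i3', -, -, -, -, -, -, -, -, -⟩ := hINV m
    exact continuous_inserted_level (A m) i1 (i3 1 le_rfl) (i3' 1 le_rfl) (v (m + 1)) (hvc _) (hvper _) (E.refresh_pos (m + 1))
      (hvan m) (bf (m + 1)) fun t x => by rw [hbS, hINS]
  · -- (L2) every level field is weakly divergence free: change of variables by the volume-preserving coarse flow
    set w : ℝ := (⌊t / E.refresh (m + 1)⌋ : ℝ) * E.refresh (m + 1) with hw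
    have hΦΨ : ∀ z, A m t ((A m w).symm (A m w ((A m t).symm z))) = z := fun z => by simp
    have hu : Continuous (E.toFractalCarrierData.level (m + 1) t) := (isSmooth_level E.toFractalCarrierData (m + 1) t).continuous
    have e : (fun x : UnitAddTorus (Fin 3) => proj (A m w ((A m t).symm (repr x)))) = fun x => x + proj (dsp m w t x) :=
      funext fun x => by rw [hdsp, add_proj_disp_eq (fun y' => A m w ((A m t).symm y')) x]
    have hMP : MeasurePreserving (fun x : UnitAddTorus (Fin 3) => proj (A m w ((A m t).symm (repr x)))) volume volume := by
      rw [e]; exact hMPall m w t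
    exact isWeaklyDivFree_pushforward (fun z => A m t ((A m w).symm z)) (fun z => A m w ((A m t).symm z)) hΦΨ (hXeqm m t w)
      ((hAinf m t).1.comp (hAinf m w).2) _ (isWeaklyDivFree_level _ _ _) hu hMP (bf (m + 1) t) fun x => by
        rw [hbS, hINS, hv]
  · -- (L3a) every level field is smooth in space
    show ContDiff ℝ ∞ (Torus.lift (bf (m + 1) t))
    have hper : ∀ z (k' : Fin 3 → ℤ), INS m t (z + latticeVec k') = INS m t z := fun z k' => by
      rw [hINS, hINS]; exact inserted_add_latticeVec (A m) (v (m + 1)) t _ (hINV m).1 (hvper _) z k'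
    have hl : Torus.lift (bf (m + 1) t) = INS m t := by
      funext z; rw [Torus.lift_apply, hbS, periodic_repr_proj hper]
    rw [hl, show INS m t = fun z => INS m t z from rfl]
    simp only [hINS]
    set w : ℝ := (⌊t / E.refresh (m + 1)⌋ : ℝ) * E.refresh (m + 1) with hw
    have hF : ContDiff ℝ ∞ fun y => A m t ((A m w).symm y) := (hAinf m t).1.comp (hAinf m w).2
    have hq : ContDiff ℝ ∞ fun z => A m w ((A m t).symm z) := (hAinf m w).1.comp (hAinf m t).2
    have hvs : ContDiff ℝ ∞ fun y => v (m + 1) t y := by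
      have e : (fun y => v (m + 1) t y) = Torus.lift (E.toFractalCarrierData.level (m + 1) t) :=
        funext fun y => by rw [hv, Torus.lift_apply]
      rw [e]; exact isSmooth_level _ _ _
    have hD : ContDiff ℝ ∞ fun p : EuclideanSpace ℝ (Fin 3) × EuclideanSpace ℝ (Fin 3) =>
        fderiv ℝ (fun y => A m t ((A m w).symm y)) p.1 p.2 := hF.contDiff_fderiv_apply (by simp)
    exact hD.comp (hq.prodMk (hvs.comp hq))
  · -- (L4) every level field is time periodic with period `refresh 1`
    funext x
    show bf (m + 1) (t + E.refresh 1) x = bf (m + 1) t x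
    rw [hbS, hbS, hINSper']
  · -- (F1a) every displacement is jointly continuous in `(t, x)`
    obtain ⟨i1, i3, -, -, -, -, -, -, -, -, -, -⟩ := hINV m
    have hAs : ContDiff ℝ 1 (A m s).symm := (hAinf m s).2.of_le (by exact_mod_cast le_top)
    exact continuous_disp_of_slabs (A m) i1 (i3 1 le_rfl) s hAs (fun t x => dsp m t s x) fun t x => hdsp m t s x
  · -- (F1b) every displacement is smooth in space
    show ContDiff ℝ ∞ (Torus.lift (dsp m t s))
    have hl : Torus.lift (dsp m t s) = fun z => A m t ((A m s).symm z) - z := by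
      funext z
      have e : dsp m t s = fun x => (fun y' => A m t ((A m s).symm y')) (repr x) - repr x := funext fun x => hdsp m t s x
      rw [e]
      exact lift_disp_eq (F := fun y' => A m t ((A m s).symm y')) (hXeqm m t s) z
    rw [hl]
    exact ((hAinf m t).1.comp (hAinf m s).2).sub contDiff_id
  · -- (F2a) `X m s s = id`
    funext x
    show x + proj (dsp m s s x) = x
    rw [hdsp, add_proj_disp_eq (fun y' => A m s ((A m s).symm y')) x]
    simp only [Equiv.apply_symm_apply, proj_repr]
  · -- (F2b) the two-parameter group law
    funext x
    show (x + proj (dsp m s r x)) + proj (dsp m t s (x + proj (dsp m s r x))) = x + proj (dsp m t r x)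
    rw [hdsp m s r, add_proj_disp_eq (fun y' => A m s ((A m r).symm y')) x]
    rw [hdsp m t s, add_proj_disp_eq (fun y' => A m t ((A m s).symm y')) _]
    rw [hdsp m t r, add_proj_disp_eq (fun y' => A m t ((A m r).symm y')) x]
    obtain ⟨k', hk'⟩ := exists_repr_proj_eq_add_latticeVec_holds (A m s ((A m r).symm (repr x)))
    rw [hk', hXeqm m t s, Torus.proj_add_latticeVec]
    simp

  · -- (F2c) volume preservation
    exact hMPall m t s

end Summit.AnomalousDissipation.AnomalousDissipation.Theorems.SolenoidalFractalHomogenisation.LagrangianCarrierConstruction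

end
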